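import Mathlib
import HarnessLib
import Literature.Analysis.FluidPDE.Tao2016AveragedNS.LocalCascadeSolutions
import Literature.Analysis.FluidPDE.Tao2016AveragedNS.RenormalisedCascadeWaves
import Literature.Analysis.FluidPDE.Tao2016AveragedNS.ViscousEternalSolutions
import Literature.Analysis.FluidPDE.Tao2016AveragedNS.SelfSimilarCascadeBlowup
import Literature.Analysis.FluidPDE.Tao2016AveragedNS.BoundedEternalSolutions
import Summits.NavierStokesRegularity.NavierStokesRegularity.Theorems.TaoLadderRungTwoBreakNoSurvivingEternalViscBddOneTailBarrier

/-!
# Crux K1(1) `TaoLadderRungTwoBreak.NoSurvivingDSSOne` (stmt-NavierStokesRegularity-20205): every admissible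
# DSS wave of a cancelling table has a DOUBLY-EXPONENTIAL LEADING EDGE and ORDERED IGNITION

MODEL lattice ODEs only (Tao 2016 §4 in the self-similar log-time variables of §6.4); nothing in this file
is a statement about the Navier–Stokes equations, and no summit or rung LEAF is proved by it
(`--supports stmt-NavierStokesRegularity-20205 --as helper`).  General `m`, any finite profile family,
any table with the cancellation (4.3), every `ε₀ > 0`; `C_A = fluxConst α`, `Λ = bigLam ε₀`.

The tail barrier of `…NoSurvivingEternalViscBddOneTailBarrier` needs one hypothesis at `ν̂ = 0`: a tail
that is quiet in some past.  For the eternal solution `dssEmbed π T Φ r₀` carried by an admissible DSS wave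
(`IsDSSWave`: the objects ⟨20205⟩ quantifies over) that hypothesis is a THEOREM:

* `dss_tendsto_norm_atBot` — every profile of an admissible DSS wave tends to `0` at `-∞`
  (`‖Φ_r‖²` and its derivative are integrable on a left half-line: integrable summed mass + bounded
  profiles (`IsDSSWave.uniformBound`) + the profile equation; Mathlib's
  `tendsto_zero_of_hasDerivAt_of_integrableOn_Iic`);
* `dss_exists_quietPast` — hence every tail `k ≥ n` of `dssEmbed π T Φ r₀` is quiet at any level
  `q > 0` on some `(-∞, σ₀]` (finitely many profiles, delay `T > 0`);
* `dss_orderedIgnition`, `dss_loud_downset` — ORDERED IGNITION for every admissible DSS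
  wave of a cancelling table: a shell reaches the margin level only after the shell below exceeded every
  sub-ignition level; at the canonical level `q₀ = 1/(4Λ(C_A+1))` the loud set is a down-set;
* `dss_leadingEdge_doublyExponential` — above a quiet driver the embedded shells obey
  `‖W_j(s)‖ ≤ (2ΛC_A)⁻¹(2ΛC_A q)^{2^{j+1}}` on a left half-line, for EVERY `q > 0` with `4 C_A q ≤ Λ`;
* `dss_profile_leadingEdge` — read on ONE profile through the period `p` of the shape
  permutation: `‖Φ_{r₀}(x)‖ ≤ (2ΛC_A)⁻¹ (2ΛC_A q)^{2^{jp+1}}` for `x ≤ x₁ - jpT`, every `j` — the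
  leading edge of an admissible DSS profile decays DOUBLY EXPONENTIALLY (faster than any exponential),
  the necessary shape of every front a construction for the refutation side of ⟨20205⟩/⟨20419⟩ must
  produce (compare the inner-front tails `exp(-A e^{-aξ})` of route WakeRatchet's dyadic door).

HONEST LABEL: structure lemmas about MODEL DSS waves; `stub_eternalLiouville` and ⟨20205⟩ stay OPEN; rung 0.
-/

noncomputable section

-- the summit and its single sub-problem share the name (CONVENTIONS §1)
set_option linter.dupNamespace false

namespace Summit.NavierStokesRegularity.NavierStokesRegularity.Theorems.NoSurvivingDSSOne.LeadingEdge

open Set Filter Topology MeasureTheory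
open scoped RealInnerProductSpace
open Literature.Analysis.FluidPDE Literature.Analysis.FluidPDE.TaoCascade
open Summit.NavierStokesRegularity.NavierStokesRegularity.Theorems.NoSurvivingEternalViscBddOne
open Summit.NavierStokesRegularity.NavierStokesRegularity.Theorems.NoSurvivingEternalViscBddOne.TailBarrier

variable {ρ : Type*} [Fintype ρ] {m : ℕ} {ε₀ : ℝ} {α : Fin m → Fin m → Fin m → ℤ × ℤ × ℤ → ℝ}
  {π : Equiv.Perm ρ} {T : ℝ} {Φ : ρ → ℝ → Em m}

/-! ## Profiles of an admissible DSS wave vanish at `-∞` -/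

/-- **Every profile of an admissible DSS wave tends to `0` at `-∞`.**  (`‖Φ_r‖² ≤ D‖Φ_r‖` and
`|(‖Φ_r‖²)'| = 2|⟪Φ_r, Φ_r'⟫| ≤ 2K‖Φ_r‖` are integrable — the summed mass is integrable and the profiles are
bounded — so `‖Φ_r‖² → 0` at `-∞`.)
[cite: Tao2016AveragedNS, §4 Lemma 4.1 (4.8) (the profile system); cell admissibility clauses of `IsDSSWave`] -/
theorem dss_tendsto_norm_atBot
    (hε : 0 < ε₀) (hW : IsDSSWave ε₀ α π T Φ) (r : ρ) :
    Tendsto (fun x => ‖Φ r x‖) atBot (𝓝 0) := by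
  obtain ⟨D, hD⟩ := hW.uniformBound
  have hD0 : 0 ≤ D := (norm_nonneg _).trans (hD r 0)
  have hΛ : 0 < bigLam ε₀ := bigLam_pos (by linarith)
  have hcont : ∀ r', Continuous (Φ r') := fun r' =>
    continuous_iff_continuousAt.2 fun x => (hW.wave r' x).continuousAt
  -- integrability of one profile's norm
  have hint : Integrable (fun x => ‖Φ r x‖) := by
    refine hW.mass.mono' (hcont r).norm.aestronglyMeasurable (Eventually.of_forall fun x => ?_)
    rw [Real.norm_eq_abs, abs_of_nonneg (norm_nonneg _)]
    exact norm_le_sMass Φ x r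
  -- the derivative bound
  set CQ : ℝ := shiftConst α (0, 0, 0) with hCQ
  set CA : ℝ := shiftConst α (0, 0, 1) with hCA
  set CB : ℝ := shiftConst α (1, 0, 0) + shiftConst α (0, 1, 0) with hCB
  have hCQ0 : 0 ≤ CQ := shiftConst_nonneg α _
  have hCA0 : 0 ≤ CA := shiftConst_nonneg α _
  have hCB0 : 0 ≤ CB := add_nonneg (shiftConst_nonneg α _) (shiftConst_nonneg α _)
  set K : ℝ := D + CQ * D ^ 2 + bigLam ε₀ * (CA * D ^ 2) + (bigLam ε₀)⁻¹ * (CB * D * D) with hK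
  have hK0 : 0 ≤ K := by positivity
  have hderiv_bound : ∀ x, ‖deriv (Φ r) x‖ ≤ K := by
    intro x
    rw [(hW.wave r x).deriv]
    have h1 : ‖-((1 : ℝ) • Φ r x)‖ ≤ D := by rw [norm_neg, one_smul]; exact hD r x
    have h2 : ‖tableQ α (Φ r x)‖ ≤ CQ * D ^ 2 :=
      (norm_tableQ_le α _).trans
        (mul_le_mul_of_nonneg_left (pow_le_pow_left₀ (norm_nonneg _) (hD r x) 2) hCQ0)
    have h3 : ‖bigLam ε₀ • tableA α (Φ (π.symm r) (x + T))‖ ≤ bigLam ε₀ * (CA * D ^ 2) := by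
      rw [norm_smul, Real.norm_eq_abs, abs_of_pos hΛ]
      exact mul_le_mul_of_nonneg_left ((norm_tableA_le α _).trans
        (mul_le_mul_of_nonneg_left (pow_le_pow_left₀ (norm_nonneg _) (hD _ _) 2) hCA0)) hΛ.le
    have h4 : ‖(bigLam ε₀)⁻¹ • tableB α (Φ (π r) (x - T)) (Φ r x)‖
        ≤ (bigLam ε₀)⁻¹ * (CB * D * D) := by
      rw [norm_smul, Real.norm_eq_abs, abs_of_pos (inv_pos.2 hΛ)]
      refine mul_le_mul_of_nonneg_left ?_ (inv_pos.2 hΛ).le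
      calc ‖tableB α (Φ (π r) (x - T)) (Φ r x)‖ ≤ CB * ‖Φ (π r) (x - T)‖ * ‖Φ r x‖ :=
            norm_tableB_le α _ _
        _ ≤ CB * D * D := by
            apply mul_le_mul (mul_le_mul_of_nonneg_left (hD _ _) hCB0) (hD r x) (norm_nonneg _)
            positivity
    calc ‖-((1 : ℝ) • Φ r x) + tableQ α (Φ r x) + bigLam ε₀ • tableA α (Φ (π.symm r) (x + T))
          + (bigLam ε₀)⁻¹ • tableB α (Φ (π r) (x - T)) (Φ r x)‖
        ≤ ‖-((1 : ℝ) • Φ r x) + tableQ α (Φ r x) + bigLam ε₀ • tableA α (Φ (π.symm r) (x + T))‖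
          + ‖(bigLam ε₀)⁻¹ • tableB α (Φ (π r) (x - T)) (Φ r x)‖ := norm_add_le _ _
      _ ≤ (‖-((1 : ℝ) • Φ r x) + tableQ α (Φ r x)‖ + ‖bigLam ε₀ • tableA α (Φ (π.symm r) (x + T))‖)
          + ‖(bigLam ε₀)⁻¹ • tableB α (Φ (π r) (x - T)) (Φ r x)‖ := by
          gcongr; exact norm_add_le _ _
      _ ≤ ((‖-((1 : ℝ) • Φ r x)‖ + ‖tableQ α (Φ r x)‖) + ‖bigLam ε₀ • tableA α (Φ (π.symm r) (x + T))‖)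
          + ‖(bigLam ε₀)⁻¹ • tableB α (Φ (π r) (x - T)) (Φ r x)‖ := by
          gcongr; exact norm_add_le _ _
      _ ≤ ((D + CQ * D ^ 2) + bigLam ε₀ * (CA * D ^ 2)) + (bigLam ε₀)⁻¹ * (CB * D * D) := by
          gcongr
      _ = K := by rw [hK]
  -- f = ‖Φ r‖², f' = 2⟪Φ r, Φ r'⟫
  have hf : ∀ x ∈ Iic (0 : ℝ), HasDerivAt (fun y => ‖Φ r y‖ ^ 2) (2 * ⟪Φ r x, deriv (Φ r) x⟫) x :=
    fun x _ => ((hW.wave r x).differentiableAt.hasDerivAt).norm_sq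
  have hf'meas : AEStronglyMeasurable (fun x => 2 * ⟪Φ r x, deriv (Φ r) x⟫)
      (volume.restrict (Iic (0 : ℝ))) := by
    have h1 : Measurable (fun x => ⟪Φ r x, deriv (Φ r) x⟫) :=
      (hcont r).measurable.inner (measurable_deriv (Φ r))
    exact (h1.const_mul 2).aestronglyMeasurable
  have hf'int : IntegrableOn (fun x => 2 * ⟪Φ r x, deriv (Φ r) x⟫) (Iic (0 : ℝ)) := by
    refine Integrable.mono' ((hint.const_mul (2 * K)).integrableOn) hf'meas
      (Eventually.of_forall fun x => ?_)
    rw [Real.norm_eq_abs, abs_mul, abs_two]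
    calc 2 * |⟪Φ r x, deriv (Φ r) x⟫| ≤ 2 * (‖Φ r x‖ * ‖deriv (Φ r) x‖) :=
          mul_le_mul_of_nonneg_left (abs_real_inner_le_norm _ _) two_pos.le
      _ ≤ 2 * (‖Φ r x‖ * K) :=
          mul_le_mul_of_nonneg_left (mul_le_mul_of_nonneg_left (hderiv_bound x) (norm_nonneg _))
            two_pos.le
      _ = 2 * K * ‖Φ r x‖ := by ring
  have hfint : IntegrableOn (fun y => ‖Φ r y‖ ^ 2) (Iic (0 : ℝ)) := by
    refine Integrable.mono' ((hint.const_mul D).integrableOn)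
      (((hcont r).norm.pow 2).aestronglyMeasurable) (Eventually.of_forall fun x => ?_)
    rw [Real.norm_eq_abs, abs_of_nonneg (by positivity)]
    calc ‖Φ r x‖ ^ 2 = ‖Φ r x‖ * ‖Φ r x‖ := sq _
      _ ≤ D * ‖Φ r x‖ := mul_le_mul_of_nonneg_right (hD r x) (norm_nonneg _)
  have hsq : Tendsto (fun y => ‖Φ r y‖ ^ 2) atBot (𝓝 0) :=
    tendsto_zero_of_hasDerivAt_of_integrableOn_Iic hf hf'int hfint
  have hsqrt := (Real.continuous_sqrt.tendsto 0).comp hsq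
  rw [Real.sqrt_zero] at hsqrt
  refine hsqrt.congr fun x => ?_
  simp only [Function.comp_apply, Real.sqrt_sq (norm_nonneg _)]

/-- **Every tail of the eternal solution carried by an admissible DSS wave is quiet in the far past**: for
every shell `n` and level `q > 0` there is `σ₀` with `‖(dssEmbed π T Φ r₀) k s‖ ≤ q` for all `k ≥ n`,
`s ≤ σ₀` (finitely many profiles, each `→ 0` at `-∞`; shell `k ≥ n` sits at phase `s - kT ≤ σ₀ - nT`).
[cite: Tao2016AveragedNS, §4 Lemma 4.1 (4.8); cell vocabulary `dssEmbed`] -/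
theorem dss_exists_quietPast
    (hε : 0 < ε₀) (hW : IsDSSWave ε₀ α π T Φ) (r₀ : ρ) (n : ℤ) {q : ℝ} (hq : 0 < q) :
    ∃ σ₀ : ℝ, ∀ k : ℤ, n ≤ k → ∀ s, s ≤ σ₀ → ‖dssEmbed π T Φ r₀ k s‖ ≤ q := by
  have hT := hW.delay_pos
  have hall : ∀ᶠ x in atBot, ∀ r : ρ, ‖Φ r x‖ ≤ q := by
    refine eventually_all.2 fun r => ?_
    exact (dss_tendsto_norm_atBot hε hW r).eventually (eventually_le_nhds hq)
  obtain ⟨x₀, hx₀⟩ := eventually_atBot.1 hall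
  refine ⟨x₀ + n * T, fun k hk s hs => ?_⟩
  simp only [dssEmbed]
  apply hx₀
  have hkn : (n : ℝ) ≤ (k : ℝ) := by exact_mod_cast hk
  nlinarith

/-! ## Ordered ignition and the doubly-exponential leading edge of a DSS wave -/

/-- **ORDERED IGNITION for admissible DSS waves.**  Let `Φ` be an admissible DSS wave of a cancelling table
(`ε₀ > 0`), `W = dssEmbed π T Φ r₀` its eternal solution, and `q > 0` a level with `4 C_A q ≤ Λ` and
`2 Λ C_A q² < q`.  If some shell `k ≥ n` exceeds `q` at a log-time `s ≤ σ₁`, then the shell `n - 1`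
exceeded every sub-ignition level `M` (`2 Λ C_A M² < q`) at some log-time `≤ σ₁`.
[cite: Tao2016AveragedNS, §4 (4.1), (4.3), Lemma 4.1 (4.8); §5; §6.4] -/
theorem dss_orderedIgnition
    (hε : 0 < ε₀) (hW : IsDSSWave ε₀ α π T Φ) (hc : IsCancellingCoeff α) (r₀ : ρ) {q : ℝ}
    (hq0 : 0 < q) (hq4 : 4 * fluxConst α * q ≤ bigLam ε₀)
    (hq2 : 2 * bigLam ε₀ * fluxConst α * q ^ 2 < q) {n k : ℤ} (hk : n ≤ k) {σ₁ s : ℝ} (hs : s ≤ σ₁)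
    (hloud : q < ‖dssEmbed π T Φ r₀ k s‖) {M : ℝ} (hMq : 2 * bigLam ε₀ * fluxConst α * M ^ 2 < q) :
    ∃ s', s' ≤ σ₁ ∧ M < ‖dssEmbed π T Φ r₀ (n - 1) s'‖ := by
  have hE : IsEternalVisc ε₀ 0 α (dssEmbed π T Φ r₀) :=
    isEternalVisc_zero_iff.2 (hW.isEternal_dssEmbed r₀)
  obtain ⟨σ₀, hσ₀⟩ := dss_exists_quietPast hε hW r₀ n hq0
  have h0 : ∀ k' : ℤ, n ≤ k' → ∀ s', s' ≤ min σ₀ σ₁ → ‖dssEmbed π T Φ r₀ k' s'‖ ≤ q :=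
    fun k' hk' s' hs' => hσ₀ k' hk' s' (hs'.trans (min_le_left _ _))
  exact orderedIgnition_of_quietPast hε hE hc (uniformBound_dssEmbed hW r₀) (min_le_right σ₀ σ₁)
    hq4 hq2 h0 hk hs hloud hMq

/-- **The loud set of an admissible DSS wave is a down-set.**  At the canonical level
`q₀ = 1/(4Λ(C_A+1))`: if shell `k` of `dssEmbed π T Φ r₀` is loud (`> q₀`) at some `s ≤ σ₁`, then every
shell `j ≤ k` was loud at some log-time `≤ σ₁` (cancelling table, `ε₀ > 0`).
[cite: Tao2016AveragedNS, §4 (4.1), (4.3), Lemma 4.1 (4.8); §5; §6.4] -/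
theorem dss_loud_downset
    (hε : 0 < ε₀) (hW : IsDSSWave ε₀ α π T Φ) (hc : IsCancellingCoeff α) (r₀ : ρ) {k : ℤ} {σ₁ s : ℝ}
    (hs : s ≤ σ₁) (hloud : 1 / (4 * bigLam ε₀ * (fluxConst α + 1)) < ‖dssEmbed π T Φ r₀ k s‖) :
    ∀ j : ℤ, j ≤ k → ∃ s', s' ≤ σ₁ ∧ 1 / (4 * bigLam ε₀ * (fluxConst α + 1)) < ‖dssEmbed π T Φ r₀ j s'‖ := by
  have hΛ1 : 1 ≤ bigLam ε₀ := one_le_bigLam hε.le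
  have hΛ : 0 < bigLam ε₀ := by linarith
  have hCA : 0 ≤ fluxConst α := fluxConst_nonneg α
  set q : ℝ := 1 / (4 * bigLam ε₀ * (fluxConst α + 1)) with hq
  have hq0 : 0 < q := by rw [hq]; positivity
  have hqd : q * (4 * bigLam ε₀ * (fluxConst α + 1)) = 1 := by
    rw [hq]; field_simp
  have hq4 : 4 * fluxConst α * q ≤ bigLam ε₀ := by
    have h1 : 4 * fluxConst α * q ≤ 4 * (fluxConst α + 1) * bigLam ε₀ * q := by
      have : fluxConst α ≤ (fluxConst α + 1) * bigLam ε₀ := by nlinarith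
      nlinarith
    have h2 : 4 * (fluxConst α + 1) * bigLam ε₀ * q = 1 := by linarith [hqd]
    linarith
  have hq2 : 2 * bigLam ε₀ * fluxConst α * q ^ 2 < q := by
    have h1 : 2 * bigLam ε₀ * fluxConst α * q < 1 := by nlinarith [mul_pos hΛ hq0]
    nlinarith
  suffices H : ∀ d : ℕ, ∀ j : ℤ, j = k - d → ∃ s', s' ≤ σ₁ ∧ q < ‖dssEmbed π T Φ r₀ j s'‖ by
    intro j hj
    obtain ⟨d, hd⟩ : ∃ d : ℕ, j = k - d := ⟨(k - j).toNat, by omega⟩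
    exact H d j hd
  intro d
  induction d with
  | zero =>
    intro j hj
    simp only [Nat.cast_zero, sub_zero] at hj
    subst hj
    exact ⟨s, hs, hloud⟩
  | succ d ih =>
    intro j hj
    obtain ⟨s', hs', hloud'⟩ := ih (k - d) rfl
    have hjn : j = (k - d) - 1 := by rw [hj]; push_cast; ring
    obtain ⟨s'', hs'', h''⟩ := dss_orderedIgnition hε hW hc r₀ hq0 hq4 hq2 (n := k - d) le_rfl hs'
      hloud' hq2
    exact ⟨s'', hs'', by rw [hjn]; exact h''⟩

/-- **DOUBLY-EXPONENTIAL LEADING EDGE of an admissible DSS wave (shell form).**  For every level `q > 0` with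
`4 C_A q ≤ Λ` there is a log-time `σ₁` such that the shells `j ≥ 0` of `W = dssEmbed π T Φ r₀` satisfy
`‖W_j(s)‖ ≤ (2ΛC_A)⁻¹ (2 Λ C_A q)^{2^{j+1}}` for all `s ≤ σ₁` (cancelling table, `ε₀ > 0`).
[cite: Tao2016AveragedNS, §4 (4.1), (4.3), Lemma 4.1 (4.5), (4.8); §6.4] -/
theorem dss_leadingEdge_doublyExponential
    (hε : 0 < ε₀) (hW : IsDSSWave ε₀ α π T Φ) (hc : IsCancellingCoeff α) (r₀ : ρ) {q : ℝ}
    (hq0 : 0 < q) (hq4 : 4 * fluxConst α * q ≤ bigLam ε₀) :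
    ∃ σ₁ : ℝ, ∀ (j : ℕ) (s : ℝ), s ≤ σ₁ →
      ‖dssEmbed π T Φ r₀ j s‖
        ≤ (2 * bigLam ε₀ * fluxConst α)⁻¹ * (2 * bigLam ε₀ * fluxConst α * q) ^ (2 ^ (j + 1)) := by
  have hE : IsEternalVisc ε₀ 0 α (dssEmbed π T Φ r₀) :=
    isEternalVisc_zero_iff.2 (hW.isEternal_dssEmbed r₀)
  obtain ⟨σ₀, hσ₀⟩ := dss_exists_quietPast hε hW r₀ (-1) hq0
  refine ⟨σ₀, fun j s hs => ?_⟩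
  have hq : ∀ k : ℤ, (0 : ℤ) ≤ k → ∀ s', s' ≤ σ₀ → ‖dssEmbed π T Φ r₀ k s'‖ ≤ q :=
    fun k hk s' hs' => hσ₀ k (by omega) s' hs'
  have hM : ∀ s', s' ≤ σ₀ → ‖dssEmbed π T Φ r₀ (0 - 1) s'‖ ≤ q :=
    fun s' hs' => hσ₀ (0 - 1) (by norm_num) s' hs'
  have h := TailBarrier.leadingEdge_doublyExponential hε hE hc (uniformBound_dssEmbed hW r₀) (n := 0) hq4
    hq hM j s hs
  simpa only [zero_add] using h

/-- **DOUBLY-EXPONENTIAL LEADING EDGE of an admissible DSS profile (profile form).**  For every profile `r₀`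
of an admissible DSS wave of a cancelling table (`ε₀ > 0`) and every level `q > 0` with `4 C_A q ≤ Λ` there
is `x₁` with `‖Φ_{r₀}(x)‖ ≤ (2ΛC_A)⁻¹ (2 Λ C_A q)^{2^{jp+1}}` whenever `x ≤ x₁ - (jp)·T`, for every
`j : ℕ`, where `p = orderOf π` is the period of the shape permutation: the leading edge of a DSS profile
decays DOUBLY EXPONENTIALLY at `-∞` (each period `pT` further to the left squares the bound `p` times).
[cite: Tao2016AveragedNS, §4 (4.1), (4.3), Lemma 4.1 (4.5), (4.8); §6.4] -/
theorem dss_profile_leadingEdge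
    (hε : 0 < ε₀) (hW : IsDSSWave ε₀ α π T Φ) (hc : IsCancellingCoeff α) (r₀ : ρ) {q : ℝ}
    (hq0 : 0 < q) (hq4 : 4 * fluxConst α * q ≤ bigLam ε₀) :
    ∃ x₁ : ℝ, ∀ (j : ℕ) (x : ℝ), x ≤ x₁ - ((j * orderOf π : ℕ) : ℝ) * T →
      ‖Φ r₀ x‖ ≤ (2 * bigLam ε₀ * fluxConst α)⁻¹
        * (2 * bigLam ε₀ * fluxConst α * q) ^ (2 ^ (j * orderOf π + 1)) := by
  obtain ⟨σ₁, hσ₁⟩ := dss_leadingEdge_doublyExponential hε hW hc r₀ hq0 hq4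
  refine ⟨σ₁, fun j x hx => ?_⟩
  have hperm : (π ^ ((j * orderOf π : ℕ) : ℤ)) r₀ = r₀ := by
    rw [zpow_natCast, mul_comm, pow_mul, pow_orderOf_eq_one, one_pow]; rfl
  have h := hσ₁ (j * orderOf π) (x + ((j * orderOf π : ℕ) : ℝ) * T) (by linarith)
  have he : dssEmbed π T Φ r₀ ((j * orderOf π : ℕ) : ℤ) (x + ((j * orderOf π : ℕ) : ℝ) * T)
      = Φ r₀ x := by
    simp only [dssEmbed, hperm, Int.cast_natCast]
    congr 1; ring
  rw [he] at h
  exact h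

end Summit.NavierStokesRegularity.NavierStokesRegularity.Theorems.NoSurvivingDSSOne.LeadingEdge

end
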